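/-
Copyright (c) 2026 the pub-hodgecm-mathlib formalisation cell (harness21).  Prover seat hodgecm-mathlib-LH7-p04 (g3), 2026-09-02 (LH7 leaf ED. 3 road,
print organ O8a `PKsaU2Shape`: the `L²` half of Kneser's argument «invariance under `SL(F_S)` + strong approximation ⇒ invariance under `SL(𝔸)`»).
-/
import Literature.NumberTheory.Automorphic.AutomorphicQuotientSubgroupErgodic
import HarnessLib

/-!
# Kneser saturation: a.e. invariance under a relatively open subgroup `M₀` of a closed normal `N` spreads to `N` when `N ∩ Stab(x₀)` is dense in `N`

Topic `NumberTheory/Automorphic`; THEOREMS ONLY (no definition, no instance, no named fact, no notation, no `sorry`).  Sequel of ★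
`AutomorphicQuotientSubgroupErgodic` (Moore's lemma), same strictification technique, different conclusion.

THE MATHEMATICS ([PlatonovRapinchuk1994] §7.4, proof of Prop. 7.13 ∕ Kneser's «`φ(x n) = φ(γ x m)`» step; [Kneser1966]).  Let a locally compact second
countable group `G` act continuously and transitively on a Borel space `X` with invariant s-finite `μ`, `x₀ ∈ X`, `H = Stab(x₀)`.  Let `N ⊴ G` be a
CLOSED NORMAL subgroup, `M₀ ≤ N` a subgroup OPEN IN `N` (`M₀ = U ∩ N` with `U ⊆ G` open), and suppose `N ∩ H` is DENSE IN `N`.  Then every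
measurable `s ⊆ X` (resp. measurable `f : X → E`) that is a.e. invariant under each `m ∈ M₀` is a.e. invariant under each `n ∈ N`.  Proof: for every
`g ∈ G` and `n ∈ N` there are `m ∈ M₀` and `d ∈ N ∩ H` with `n g = m g d` (`exists_mem_mul_mul_eq_of_subset_closure`: the set
`{g⁻¹ m⁻¹ n g | m ∈ M₀}` is open in `N`, non-empty, so it meets the dense `N ∩ H`).  Pull `s` back to `S ⊆ G` along `Θ(g) = g • x₀` (null sets
correspond, ★ `measure_eq_zero_iff_measure_preimage_orbit_eq_zero`); strictify over the Haar measure of `M₀` (closed, as an open subgroup of the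
closed `N`): `S' = {g | m g ∈ S for a.e. m ∈ M₀}` equals `S` a.e., is EXACTLY left-`M₀`-invariant and EXACTLY right-`H`-invariant; by the
decomposition it is exactly left-`N`-invariant (`n g ∈ S' ↔ m (g d) ∈ S' ↔ g d ∈ S' ↔ g ∈ S'`), and exact invariance of `S'` is a.e. invariance of
`S`, i.e. of `s`.

* §1 (abstract) `exists_mem_mul_mul_eq_of_subset_closure` (the decomposition `n g = m g d`); `isClosed_of_isOpen_inter_of_isClosed` (`M₀` is
  closed); **`preimage_smul_ae_eq_of_forall_mem_of_subset_closure`** (sets); **`comp_smul_ae_eq_of_forall_mem_of_subset_closure`** (functions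
  into a second countable metrizable space).
* §2 `AdelicGroupData.rightRegular_apply_eq_self_of_forall_mem_of_subset_closure` — for an adelic group datum with `G(𝔸_K)` locally compact second
  countable and an automorphic measure: **if `R(m) f = f` for all `m` in a subgroup `M₀` open in a closed normal `N ≤ G(𝔸_K)` with
  `N ∩ (A_G · G(K))` dense in `N`, then `R(n) f = f` for all `n ∈ N`**.

CONSUMER (cell `hodgecm-mathlib`, crux H413 = stmt-HodgeConjecture-24833, line LH7, leaf ED. 3 print organ O8a `PKsaU2Shape`): `N` = the image of
`SU(Φ₂)(𝔸_{L⁺,f})` in `U(Φ₂)(𝔸_{L⁺})`, `M₀` = `SU(Φ₂)(F_S) · (K ∩ N)` for the cofinite set `S` of finite places where the occurring `π₂` is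
one-dimensional and an open compact `K` fixing the smooth vector, `N ∩ U(Φ₂)(L⁺) ⊇ SU(Φ₂)(L⁺)` dense in `N` = STRONG APPROXIMATION for
`SU(Φ₂) ≅ SL₂` ([PlatonovRapinchuk1994] §7.4 Thm. 7.12; [Kneser1966]) — then a smooth vector of `P` fixed by `SU(Φ₂)(F_v)`, `v ∈ S`, is fixed by
all of `SU(Φ₂)(𝔸_{L⁺,f})`.  Nothing here is specific to unitary groups.
HONEST LABEL: generic measure theory; HC_CM is proved only modulo the printed citations of that programme until its rung 0 closes; this file proves no
printed citation of it.

## References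
* [PlatonovRapinchuk1994] V. Platonov, A. Rapinchuk, *Algebraic Groups and Number Theory* (1994), §7.4 (strong approximation; Thm. 7.12, Prop. 7.13).
* [Kneser1966] M. Kneser, *Strong approximation*, Proc. Sympos. Pure Math. IX (1966), 187–196.
* [Zimmer1984] R. J. Zimmer, *Ergodic theory and semisimple groups* (1984), App. B (a.e. versus strict invariance).
-/

set_option autoImplicit false

noncomputable section

open MeasureTheory Filter Set Topology
open scoped ENNReal Pointwise

namespace Literature.NumberTheory.Automorphic

/-! ## §1 Kneser saturation on a homogeneous space -/

section Abstract

variable {G X : Type*} [Group G] [TopologicalSpace G] [IsTopologicalGroup G]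
  [SecondCountableTopology G] [LocallyCompactSpace G] [MulAction G X] [TopologicalSpace X] [MeasurableSpace X]
  [BorelSpace X] [ContinuousSMul G X] [MulAction.IsPretransitive G X]

omit [SecondCountableTopology G] [LocallyCompactSpace G] [MulAction G X] [TopologicalSpace X] [MeasurableSpace X]
  [BorelSpace X] [ContinuousSMul G X] [MulAction.IsPretransitive G X] in
/-- **The decomposition `n g = m g d`.**  Let `N ⊴ G` be normal, `M₀ = U ∩ N` with `U` open, and `D ≤ G` a subgroup with `N ⊆ closure (N ∩ D)`.  Then
for every `g ∈ G` and `n ∈ N` there are `m ∈ M₀` and `d ∈ N ∩ D` with `n * g = m * g * d`: the set `{d | n g d⁻¹ g⁻¹ ∈ U}` is open, contains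
`g⁻¹ n g ∈ N`, hence meets `N ∩ D`. [cite: PlatonovRapinchuk1994, §7.4 Prop. 7.13 (proof)] -/
theorem exists_mem_mul_mul_eq_of_subset_closure (N M₀ D : Subgroup G) [N.Normal] {U : Set G} (hU : IsOpen U)
    (hUM : U ∩ (N : Set G) = (M₀ : Set G)) (hdense : (N : Set G) ⊆ closure ((N : Set G) ∩ (D : Set G)))
    (g : G) {n : G} (hn : n ∈ N) :
    ∃ m ∈ M₀, ∃ d ∈ D, d ∈ N ∧ n * g = m * g * d := by
  set T : Set G := {d | n * g * d⁻¹ * g⁻¹ ∈ U} with hT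
  have hTo : IsOpen T :=
    hU.preimage (((continuous_const.mul continuous_inv).mul continuous_const))
  have hd₀N : g⁻¹ * n * g ∈ N := by
    have := Subgroup.Normal.conj_mem inferInstance n hn g⁻¹
    simpa only [inv_inv] using this
  have hd₀T : g⁻¹ * n * g ∈ T := by
    simp only [hT, mem_setOf_eq, mul_inv_rev, inv_inv]
    rw [show n * g * (g⁻¹ * (n⁻¹ * g)) * g⁻¹ = 1 by group]
    have h1 : (1 : G) ∈ U ∩ (N : Set G) := by rw [hUM]; exact M₀.one_mem
    exact h1.1
  obtain ⟨d, hdT, hdN, hdD⟩ := (mem_closure_iff.1 (hdense hd₀N) T hTo hd₀T)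
  refine ⟨n * g * d⁻¹ * g⁻¹, ?_, d, hdD, hdN, by group⟩
  have hmN : n * g * d⁻¹ * g⁻¹ ∈ (N : Set G) := by
    have h1 : g * d⁻¹ * g⁻¹ ∈ N := Subgroup.Normal.conj_mem inferInstance d⁻¹ (N.inv_mem hdN) g
    have h2 : n * (g * d⁻¹ * g⁻¹) ∈ N := N.mul_mem hn h1
    rw [SetLike.mem_coe]
    simpa only [mul_assoc] using h2
  have : n * g * d⁻¹ * g⁻¹ ∈ U ∩ (N : Set G) := ⟨hdT, hmN⟩
  rwa [hUM] at this

omit [SecondCountableTopology G] [LocallyCompactSpace G] [MulAction G X] [TopologicalSpace X] [MeasurableSpace X]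
  [BorelSpace X] [ContinuousSMul G X] [MulAction.IsPretransitive G X] in
/-- A subgroup `M₀ = U ∩ N` open in a closed subgroup `N` is closed in `G` (open subgroups are closed; `N → G` is a closed embedding). [folklore]
[cite: PlatonovRapinchuk1994, §7.4] -/
theorem isClosed_of_isOpen_inter_of_isClosed (N M₀ : Subgroup G) (hN : IsClosed (N : Set G)) (hMN : M₀ ≤ N) {U : Set G}
    (hU : IsOpen U) (hUM : U ∩ (N : Set G) = (M₀ : Set G)) : IsClosed (M₀ : Set G) := by
  -- the trace of `M₀` on `N` is an open, hence closed, subgroup of `N`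
  have hopen : IsOpen ((M₀.subgroupOf N : Subgroup N) : Set N) := by
    have h1 : ((M₀.subgroupOf N : Subgroup N) : Set N) = ((↑) : N → G) ⁻¹' U := by
      ext k
      simp only [SetLike.mem_coe, Subgroup.mem_subgroupOf, mem_preimage]
      constructor
      · intro hk
        have : (k : G) ∈ U ∩ (N : Set G) := by rw [hUM]; exact hk
        exact this.1
      · intro hk
        have : (k : G) ∈ U ∩ (N : Set G) := ⟨hk, k.2⟩
        rw [hUM] at this
        exact this
    rw [h1]
    exact hU.preimage continuous_subtype_val
  have hclosedN : IsClosed ((M₀.subgroupOf N : Subgroup N) : Set N) := Subgroup.isClosed_of_isOpen _ hopen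
  have hemb : IsClosedEmbedding ((↑) : N → G) := hN.isClosedEmbedding_subtypeVal
  have himage : ((↑) : N → G) '' ((M₀.subgroupOf N : Subgroup N) : Set N) = (M₀ : Set G) := by
    ext k
    simp only [mem_image, SetLike.mem_coe, Subgroup.mem_subgroupOf]
    constructor
    · rintro ⟨k', hk', rfl⟩
      exact hk'
    · intro hk
      exact ⟨⟨k, hMN hk⟩, hk, rfl⟩
  rw [← himage]
  exact hemb.isClosedMap _ hclosedN

/-- **Kneser saturation for sets.**  Let a locally compact second countable group `G` act continuously and transitively on a Borel space `X` with an
invariant s-finite measure `μ`; let `N ⊴ G` be a closed normal subgroup, `M₀ ≤ N` a subgroup open in `N` (`U ∩ N = M₀`, `U` open), and assume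
`N ∩ Stab(x₀)` is dense in `N`.  If a measurable `s ⊆ X` satisfies `m⁻¹ s = s` a.e. for every `m ∈ M₀`, then `n⁻¹ s = s` a.e. for every `n ∈ N`.
(Strictify the pull-back `S ⊆ G` of `s` over the Haar measure of `M₀`; the strict version is exactly left-`M₀`- and right-`Stab(x₀)`-invariant,
hence exactly left-`N`-invariant by `exists_mem_mul_mul_eq_of_subset_closure`.) [cite: PlatonovRapinchuk1994, §7.4 Prop. 7.13 (proof)]
[cite: Zimmer1984, App. B] -/
theorem preimage_smul_ae_eq_of_forall_mem_of_subset_closure (μ : Measure X) [SFinite μ] [SMulInvariantMeasure G X μ]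
    (N M₀ : Subgroup G) [N.Normal] (hN : IsClosed (N : Set G)) (hMN : M₀ ≤ N) {U : Set G} (hU : IsOpen U)
    (hUM : U ∩ (N : Set G) = (M₀ : Set G)) (x₀ : X)
    (hdense : (N : Set G) ⊆ closure ((N : Set G) ∩ (MulAction.stabilizer G x₀ : Set G)))
    {s : Set X} (hs : MeasurableSet s) (hinv : ∀ m ∈ M₀, (fun x => m • x) ⁻¹' s =ᵐ[μ] s)
    {n : G} (hn : n ∈ N) : (fun x => n • x) ⁻¹' s =ᵐ[μ] s := by
  borelize G
  rcases eq_zero_or_neZero μ with rfl | hμ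
  · rw [ae_zero]; exact eventually_bot
  set ν : Measure G := Measure.haar with hν
  set Θ : G → X := fun g => g • x₀ with hΘ
  have hΘm : Measurable Θ := (continuous_id.smul continuous_const).measurable
  have key : ∀ A : Set X, MeasurableSet A → (μ A = 0 ↔ ν (Θ ⁻¹' A) = 0) := fun A hA =>
    measure_eq_zero_iff_measure_preimage_orbit_eq_zero μ ν x₀ hA
  set S : Set G := Θ ⁻¹' s with hSdef
  have hS : MeasurableSet S := hΘm hs
  -- transport of a.e. invariance between `s` and `S`, for any `g`
  have hpre : ∀ g : G, (g • ·) ⁻¹' S = Θ ⁻¹' ((g • ·) ⁻¹' s) := by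
    intro g
    ext k
    simp only [mem_preimage, hSdef, hΘ, smul_eq_mul, mul_smul]
  have htoG : ∀ g : G, (g • ·) ⁻¹' s =ᵐ[μ] s → ∀ᵐ k ∂ν, (g * k ∈ S ↔ k ∈ S) := by
    intro g h2
    have hgs : MeasurableSet ((g • ·) ⁻¹' s) := measurableSet_preimage (measurable_const_smul g) hs
    rw [ae_eq_set] at h2
    have e1 : ν ((g • ·) ⁻¹' S \ S) = 0 := by
      rw [hpre, hSdef, ← preimage_sdiff]
      exact (key _ (hgs.diff hs)).1 h2.1
    have e2 : ν (S \ (g • ·) ⁻¹' S) = 0 := by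
      rw [hpre, hSdef, ← preimage_sdiff]
      exact (key _ (hs.diff hgs)).1 h2.2
    exact eventuallyEq_set.1 (ae_eq_set.2 ⟨e1, e2⟩)
  have htoX : ∀ g : G, (g • ·) ⁻¹' S =ᵐ[ν] S → (g • ·) ⁻¹' s =ᵐ[μ] s := by
    intro g h2
    have hgs : MeasurableSet ((g • ·) ⁻¹' s) := measurableSet_preimage (measurable_const_smul g) hs
    rw [ae_eq_set] at h2 ⊢
    refine ⟨(key _ (hgs.diff hs)).2 ?_, (key _ (hs.diff hgs)).2 ?_⟩
    · rw [preimage_sdiff, ← hpre]; exact h2.1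
    · rw [preimage_sdiff, ← hpre]; exact h2.2
  have hSinv : ∀ m : M₀, ∀ᵐ k ∂ν, ((m : G) * k ∈ S ↔ k ∈ S) := fun m => htoG m (hinv m m.2)
  have hSH : ∀ h ∈ MulAction.stabilizer G x₀, ∀ g : G, g * h ∈ S ↔ g ∈ S := by
    intro h hh g
    simp only [hSdef, mem_preimage, hΘ, mul_smul, MulAction.mem_stabilizer_iff.1 hh]
  -- Haar measure on the closed subgroup `M₀`
  have hM₀ : IsClosed (M₀ : Set G) := isClosed_of_isOpen_inter_of_isClosed N M₀ hN hMN hU hUM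
  haveI : SecondCountableTopology M₀ := TopologicalSpace.Subtype.secondCountableTopology (M₀ : Set G)
  haveI : LocallyCompactSpace M₀ := hM₀.locallyCompactSpace
  set νM : Measure M₀ := Measure.haar with hνM
  have hνM0 : νM (univ : Set M₀) ≠ 0 := isOpen_univ.measure_ne_zero νM ⟨1, trivial⟩
  -- strictification
  set S' : Set G := {g | ∀ᵐ (m : M₀) ∂νM, (m : G) * g ∈ S} with hS'def
  have hmul : Measurable fun p : M₀ × G => (p.1 : G) * p.2 :=
    ((continuous_subtype_val.comp continuous_fst).mul continuous_snd).measurable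
  have hE : MeasurableSet {p : M₀ × G | (p.1 : G) * p.2 ∈ S} := hmul hS
  have hS'm : MeasurableSet S' := by
    have h := measurable_measure_prodMk_right (μ := νM) hE.compl
    have hS'eq : S' = (fun g : G => νM ((fun m : M₀ => (m, g)) ⁻¹' {p : M₀ × G | (p.1 : G) * p.2 ∈ S}ᶜ)) ⁻¹' {0} := by
      ext g
      simp only [hS'def, mem_setOf_eq, mem_preimage, mem_singleton_iff]
      rw [ae_iff]
      rfl
    rw [hS'eq]
    exact h (measurableSet_singleton 0)
  have hS'S : S' =ᵐ[ν] S := by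
    have h2 : ∀ᵐ (m : M₀) ∂νM, ∀ᵐ g ∂ν, ((m : G) * g ∈ S ↔ g ∈ S) := ae_of_all _ hSinv
    have hmeas : MeasurableSet {p : M₀ × G | ((p.1 : G) * p.2 ∈ S ↔ p.2 ∈ S)} := by
      have heq : {p : M₀ × G | ((p.1 : G) * p.2 ∈ S ↔ p.2 ∈ S)} =
          ({p : M₀ × G | (p.1 : G) * p.2 ∈ S} ∩ {p | p.2 ∈ S}) ∪ ({p : M₀ × G | (p.1 : G) * p.2 ∈ S}ᶜ ∩ {p | p.2 ∈ S}ᶜ) := by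
        ext p
        simp only [mem_setOf_eq, mem_union, mem_inter_iff, mem_compl_iff]
        tauto
      rw [heq]
      exact (hE.inter (measurable_snd hS)).union (hE.compl.inter (measurable_snd hS).compl)
    have h3 : ∀ᵐ g ∂ν, ∀ᵐ (m : M₀) ∂νM, ((m : G) * g ∈ S ↔ g ∈ S) := (Measure.ae_ae_comm hmeas).1 h2
    refine eventuallyEq_set.2 ?_
    filter_upwards [h3] with g hg
    constructor
    · intro hg'
      by_contra hgS
      have hfalse : ∀ᵐ (_m : M₀) ∂νM, False := by
        filter_upwards [hg', hg] with m hm1 hm2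
        exact hgS (hm2.1 hm1)
      have h0 := ae_iff.1 hfalse
      simp only [not_false_eq_true, setOf_true] at h0
      exact hνM0 h0
    · intro hgS
      filter_upwards [hg] with m hm
      exact hm.2 hgS
  have hS'M : ∀ (m₀ : M₀) (g : G), (m₀ : G) * g ∈ S' ↔ g ∈ S' := by
    intro m₀ g
    simp only [hS'def, mem_setOf_eq]
    have h1 : (∀ᵐ (m : M₀) ∂νM, (m : G) * ((m₀ : G) * g) ∈ S) ↔ ∀ᵐ (m : M₀) ∂νM, ((m * m₀ : M₀) : G) * g ∈ S := by
      simp only [Subgroup.coe_mul, mul_assoc]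
    rw [h1, ae_iff, ae_iff]
    exact measure_mul_right_null (s := {a : M₀ | ¬ ((a : G) * g ∈ S)}) νM m₀
  have hS'H : ∀ h ∈ MulAction.stabilizer G x₀, ∀ g : G, g * h ∈ S' ↔ g ∈ S' := by
    intro h hh g
    simp only [hS'def, mem_setOf_eq, ← mul_assoc, hSH h hh]
  -- exact left `N`-invariance of `S'` from the decomposition `n g = m g d`
  have hS'N : ∀ n' ∈ N, ∀ g : G, n' * g ∈ S' ↔ g ∈ S' := by
    intro n' hn' g
    obtain ⟨m, hm, d, hd, -, hdeq⟩ :=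
      exists_mem_mul_mul_eq_of_subset_closure N M₀ (MulAction.stabilizer G x₀) hU hUM hdense g hn'
    rw [hdeq, mul_assoc, hS'M ⟨m, hm⟩, hS'H d hd]
  -- conclusion
  have h1 : (n • ·) ⁻¹' S' = S' := by
    ext k
    simp only [mem_preimage, smul_eq_mul, hS'N n hn]
  have h2 : (n • ·) ⁻¹' S =ᵐ[ν] S := by
    have h3 : (n • ·) ⁻¹' S =ᵐ[ν] (n • ·) ⁻¹' S' :=
      ((measurePreserving_mul_left ν n).quasiMeasurePreserving).preimage_ae_eq hS'S.symm
    rw [h1] at h3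
    exact h3.trans hS'S
  exact htoX n h2

/-- **Kneser saturation for functions.**  Same setting; a strongly measurable `f : X → E` into a second countable metrizable space with
`f (m • x) = f x` a.e. for every `m ∈ M₀` satisfies `f (n • x) = f x` a.e. for every `n ∈ N` (apply the set version to the preimages of a countable
basis; two distinct values are separated by a basis element). [cite: PlatonovRapinchuk1994, §7.4 Prop. 7.13 (proof)] -/
theorem comp_smul_ae_eq_of_forall_mem_of_subset_closure {E : Type*} [TopologicalSpace E] [TopologicalSpace.MetrizableSpace E]
    [SecondCountableTopology E] [MeasurableSpace E] [BorelSpace E]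
    (μ : Measure X) [SFinite μ] [SMulInvariantMeasure G X μ]
    (N M₀ : Subgroup G) [N.Normal] (hN : IsClosed (N : Set G)) (hMN : M₀ ≤ N) {U : Set G} (hU : IsOpen U)
    (hUM : U ∩ (N : Set G) = (M₀ : Set G)) (x₀ : X)
    (hdense : (N : Set G) ⊆ closure ((N : Set G) ∩ (MulAction.stabilizer G x₀ : Set G)))
    {f : X → E} (hfm : Measurable f) (hinv : ∀ m ∈ M₀, (fun x => f (m • x)) =ᵐ[μ] f)
    {n : G} (hn : n ∈ N) : (fun x => f (n • x)) =ᵐ[μ] f := by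
  letI := TopologicalSpace.metrizableSpaceMetric E
  obtain ⟨b, hbc, -, hb⟩ := TopologicalSpace.exists_countable_basis E
  -- each basis preimage is a.e. `N`-invariant
  have hset : ∀ V ∈ b, (fun x => n • x) ⁻¹' (f ⁻¹' V) =ᵐ[μ] f ⁻¹' V := by
    intro V hV
    have hVm : MeasurableSet (f ⁻¹' V) := hfm (hb.isOpen hV).measurableSet
    refine preimage_smul_ae_eq_of_forall_mem_of_subset_closure μ N M₀ hN hMN hU hUM x₀ hdense hVm
      (fun m hm => ?_) hn
    exact (hinv m hm).preimage V
  -- hence the bad set is contained in a countable union of null sets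
  have hnull : ∀ V : b, μ (((fun x => n • x) ⁻¹' (f ⁻¹' (V : Set E))) \ (f ⁻¹' V) ∪
      ((f ⁻¹' (V : Set E)) \ ((fun x => n • x) ⁻¹' (f ⁻¹' V)))) = 0 := by
    intro V
    have h := hset V V.2
    rw [ae_eq_set] at h
    exact measure_union_null h.1 h.2
  haveI : Countable b := hbc.to_subtype
  rw [Filter.EventuallyEq, ae_iff]
  refine measure_mono_null (fun x hx => ?_) (measure_iUnion_null hnull)
  simp only [mem_setOf_eq] at hx
  -- separate `f (n • x) ≠ f x` by a basis element containing `f (n • x)` but not `f x`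
  obtain ⟨V, hVb, hV1, hV2⟩ := hb.exists_subset_of_mem_open (by exact hx : f (n • x) ∈ ({f x}ᶜ : Set E))
    isOpen_compl_singleton
  refine mem_iUnion.2 ⟨⟨V, hVb⟩, Or.inl ⟨?_, ?_⟩⟩
  · exact hV1
  · intro hxV
    exact hV2 hxV rfl

end Abstract

/-! ## §2 The automorphic quotient: `R(m) f = f` on an open subgroup of a closed normal `N` with `N ∩ (A_G · G(K))` dense in `N` gives `R(n) f = f` on `N` -/

namespace AdelicGroupData

universe u

variable {K : Type} [Field K] [NumberField K] (𝒢 : AdelicGroupData.{u} K)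
  [LocallyCompactSpace 𝒢.Adelic] [SecondCountableTopology 𝒢.Adelic]
  (μ : Measure 𝒢.automorphicQuotient) [𝒢.IsAutomorphicMeasure μ]

/-- **Kneser saturation in `L²(G(𝔸_K) ⧸ A_G G(K))`.**  Let `N ≤ G(𝔸_K)` be a closed normal subgroup with `N ∩ (A_G · G(K))` dense in `N`
(strong approximation for `N`), and `M₀ ≤ N` a subgroup open in `N` (`U ∩ N = M₀` with `U` open in `G(𝔸_K)`).  If `f ∈ L²` is fixed by `R(m)` for
every `m ∈ M₀`, then `f` is fixed by `R(n)` for every `n ∈ N` (`comp_smul_ae_eq_of_forall_mem_of_subset_closure` for the transitive action on the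
automorphic quotient, stabilizer `A_G · G(K)` by Mathlib `MulAction.stabilizer_quotient`, and the a.e. formula ★ `rightRegular_apply_coeFn`).
[cite: PlatonovRapinchuk1994, §7.4 Prop. 7.13 (proof)] [cite: Kneser1966, Hauptsatz] -/
theorem rightRegular_apply_eq_self_of_forall_mem_of_subset_closure (N M₀ : Subgroup 𝒢.Adelic) [N.Normal]
    (hN : IsClosed (N : Set 𝒢.Adelic)) (hMN : M₀ ≤ N) {U : Set 𝒢.Adelic} (hU : IsOpen U)
    (hUM : U ∩ (N : Set 𝒢.Adelic) = (M₀ : Set 𝒢.Adelic))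
    (hdense : (N : Set 𝒢.Adelic) ⊆ closure ((N : Set 𝒢.Adelic) ∩ (𝒢.quotientSubgroup : Set 𝒢.Adelic)))
    {f : 𝒢.L2 μ} (hf : ∀ m ∈ M₀, 𝒢.rightRegular μ m f = f) {n : 𝒢.Adelic} (hn : n ∈ N) :
    𝒢.rightRegular μ n f = f := by
  haveI : MulAction.IsPretransitive 𝒢.Adelic 𝒢.automorphicQuotient :=
    inferInstanceAs (MulAction.IsPretransitive 𝒢.Adelic (𝒢.Adelic ⧸ 𝒢.quotientSubgroup))
  have hstab : MulAction.stabilizer 𝒢.Adelic (𝒢.toAutomorphicQuotient 1) = 𝒢.quotientSubgroup :=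
    MulAction.stabilizer_quotient 𝒢.quotientSubgroup
  have hdense' : (N : Set 𝒢.Adelic) ⊆
      closure ((N : Set 𝒢.Adelic) ∩ (MulAction.stabilizer 𝒢.Adelic (𝒢.toAutomorphicQuotient 1) : Set 𝒢.Adelic)) := by
    rw [hstab]
    exact hdense
  -- a.e. invariance of the (strongly measurable) representative under `M₀`
  have hinv : ∀ m ∈ M₀, (fun x => (f : 𝒢.automorphicQuotient → ℂ) (m • x)) =ᵐ[μ] (f : 𝒢.automorphicQuotient → ℂ) := by
    intro m hm
    have h := 𝒢.rightRegular_apply_coeFn μ m⁻¹ f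
    rw [hf _ (M₀.inv_mem hm), inv_inv] at h
    exact h.symm
  have hae : (fun x => (f : 𝒢.automorphicQuotient → ℂ) (n⁻¹ • x)) =ᵐ[μ] (f : 𝒢.automorphicQuotient → ℂ) :=
    comp_smul_ae_eq_of_forall_mem_of_subset_closure μ N M₀ hN hMN hU hUM (𝒢.toAutomorphicQuotient 1) hdense'
      (Lp.stronglyMeasurable f).measurable hinv (N.inv_mem hn)
  -- back to `L²`
  refine Lp.ext_iff.2 ?_
  exact (𝒢.rightRegular_apply_coeFn μ n f).trans hae

end AdelicGroupData

/-! ## §3 (ED. 2) Open-subgroup form: a vector fixed by an open subgroup of `N` and by generators `S₀ ⊆ N` is fixed by `N` -/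

section OpenSubgroup

variable {G : Type*} [Group G] [TopologicalSpace G] [IsTopologicalGroup G]

/-- A subgroup `M₀ ≤ N` containing `K ∩ N` for an OPEN subgroup `K` is the trace on `N` of the open set `M₀ · K`. [cite: PlatonovRapinchuk1994, §7.4] -/
theorem exists_isOpen_inter_eq_of_inf_le (N M₀ K : Subgroup G) (hK : IsOpen (K : Set G)) (hMN : M₀ ≤ N)
    (hKM : K ⊓ N ≤ M₀) : ∃ U : Set G, IsOpen U ∧ U ∩ (N : Set G) = (M₀ : Set G) := by
  refine ⟨(M₀ : Set G) * (K : Set G), hK.mul_left, Set.ext fun n => ⟨?_, ?_⟩⟩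
  · rintro ⟨hmul, hn⟩
    obtain ⟨m, hm, k, hk, rfl⟩ := Set.mem_mul.1 hmul
    have h := N.mul_mem (N.inv_mem (hMN hm)) hn
    rw [inv_mul_cancel_left] at h
    exact M₀.mul_mem hm (hKM (Subgroup.mem_inf.2 ⟨hk, h⟩))
  · exact fun hn => ⟨Set.mem_mul.2 ⟨n, hn, 1, K.one_mem, mul_one n⟩, hMN hn⟩

end OpenSubgroup

namespace AdelicGroupData

universe u'

variable {K : Type} [Field K] [NumberField K] (𝒢 : AdelicGroupData.{u'} K)
  [LocallyCompactSpace 𝒢.Adelic] [SecondCountableTopology 𝒢.Adelic]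
  (μ : Measure 𝒢.automorphicQuotient) [𝒢.IsAutomorphicMeasure μ]

/-- **Kneser saturation in `L²`, open-subgroup form.**  Let `N ≤ G(𝔸_K)` be a closed normal subgroup with `N ∩ (A_G · G(K))` dense in `N` (strong
approximation), `K ≤ G(𝔸_K)` an OPEN subgroup and `S₀ ⊆ N` a set.  If `f ∈ L²` is fixed by `R(k)` for every `k ∈ K ∩ N` and by `R(s)` for every
`s ∈ S₀`, then `f` is fixed by `R(n)` for every `n ∈ N` (the stabiliser of `f` contains the subgroup `M₀` generated by `S₀ ∪ (K ∩ N)`, open in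
`N` by `exists_isOpen_inter_eq_of_inf_le`; §2).  On LH7 ∕ O8a: `K` = a level fixing the smooth vector, `S₀ = ⋃_{v ∈ S} SU(Φ₂)(F_v)`.
[cite: PlatonovRapinchuk1994, §7.4 Prop. 7.13 (proof)] [cite: Kneser1966, Hauptsatz] -/
theorem rightRegular_apply_eq_self_of_forall_mem_of_isOpen (N : Subgroup 𝒢.Adelic) [N.Normal]
    (hN : IsClosed (N : Set 𝒢.Adelic)) (K₀ : Subgroup 𝒢.Adelic) (hK₀ : IsOpen (K₀ : Set 𝒢.Adelic))
    (S₀ : Set 𝒢.Adelic) (hS₀ : S₀ ⊆ (N : Set 𝒢.Adelic))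
    (hdense : (N : Set 𝒢.Adelic) ⊆ closure ((N : Set 𝒢.Adelic) ∩ (𝒢.quotientSubgroup : Set 𝒢.Adelic)))
    {f : 𝒢.L2 μ} (hfK : ∀ k ∈ K₀, k ∈ N → 𝒢.rightRegular μ k f = f) (hfS : ∀ s ∈ S₀, 𝒢.rightRegular μ s f = f)
    {n : 𝒢.Adelic} (hn : n ∈ N) : 𝒢.rightRegular μ n f = f := by
  -- the stabiliser of `f`
  let Stab : Subgroup 𝒢.Adelic :=
    { carrier := {g | 𝒢.rightRegular μ g f = f}
      one_mem' := by simp only [mem_setOf_eq, map_one]; rfl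
      mul_mem' := fun {a b} ha hb => by
        simp only [mem_setOf_eq] at ha hb ⊢
        rw [map_mul]; change 𝒢.rightRegular μ a (𝒢.rightRegular μ b f) = f; rw [hb, ha]
      inv_mem' := fun {a} ha => by
        simp only [mem_setOf_eq] at ha ⊢
        have h1 : (𝒢.rightRegular μ a⁻¹ * 𝒢.rightRegular μ a) f = f := by rw [← map_mul, inv_mul_cancel, map_one]; rfl
        change 𝒢.rightRegular μ a⁻¹ (𝒢.rightRegular μ a f) = f at h1
        rwa [ha] at h1 }
  set M₀ : Subgroup 𝒢.Adelic := Subgroup.closure (S₀ ∪ ((K₀ ⊓ N : Subgroup 𝒢.Adelic) : Set 𝒢.Adelic)) with hM₀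
  have hMN : M₀ ≤ N := by
    rw [hM₀, Subgroup.closure_le]
    rintro x (hx | hx)
    exacts [hS₀ hx, (Subgroup.mem_inf.1 hx).2]
  have hKM : K₀ ⊓ N ≤ M₀ := fun x hx => Subgroup.subset_closure (Or.inr hx)
  have hfix : M₀ ≤ Stab := by
    rw [hM₀, Subgroup.closure_le]
    rintro x (hx | hx)
    exacts [hfS x hx, hfK x (Subgroup.mem_inf.1 hx).1 (Subgroup.mem_inf.1 hx).2]
  obtain ⟨U, hU, hUM⟩ := exists_isOpen_inter_eq_of_inf_le N M₀ K₀ hK₀ hMN hKM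
  exact 𝒢.rightRegular_apply_eq_self_of_forall_mem_of_subset_closure μ N M₀ hN hMN hU hUM hdense
    (fun m hm => hfix hm) hn

end AdelicGroupData

end Literature.NumberTheory.Automorphic
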